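import Literature.AlgebraicGeometry.CossartPiltant200819.PStepTrichotomy2008
import HarnessLib

/-!
# Cossart–Piltant 2008, Theorem 7.2: the coarse tower (clause T-c discharged)

Sequel of `BareTower2008.lean` and `PStepTrichotomy2008.lean`. The bare moves `BMove3` still
ask, at each wild step of degree `p`, EITHER for immediacy (`galoisP`, `inseparableP`: `himm`)
OR for `f = p ∨ e = p` (`primeUp`: `hef`) — clause **T-c** of the tower fact ("either
`e = p, f = 1` or `e = 1, f = p` or `e = f = 1`", HAL ms. p. 20). By the PROVED trichotomies
`trichotomy_of_isGalois` / `trichotomy_of_pthRoot` this case distinction is automatic, so the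
coarse moves `CMove3` below carry NO `(e, f)`-hypothesis at the wild steps:

* `CMove3.galoisStep` — `L/K` Galois of degree `p = char k`, `W` the unique extension of `O`;
* `CMove3.inseparableStep` — `L = K(η)`, `ηᵖ ∈ K`, `[L : K] = p`, `k` imperfect.

PROVED here: `CMove3.toBReach3` (a coarse move is one bare move, chosen by the trichotomy),
`BMove3.toCMove3`, hence `coarseTowerExists2008_iff_bare : CoarseTowerExists2008 k ↔
BareTowerExists2008 k` and `coarseTowerExists2008_iff : CoarseTowerExists2008 k ↔
GaloisTowerExists2008 k`; and the assembled corollaries down to `LU3DiffFinite`.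
What remains NAMED in `CoarseTowerExists2008` is exactly: the Krull climb to the inertia
field (T-a(ii)), the structure of `K^r/K^i` and of `Kˢ/K^r` as towers of prime / degree-`p`
Galois steps (T-b), uniqueness of the extension along the `p`-part (T-f, Galois half) and the
assembly (T-g). [cite: CossartPiltant2008, Thm 7.2 proof (HAL pp. 20–21)]
-/

namespace Literature.AlgebraicGeometry.CossartPiltant200819.CP2008

open Literature.AlgebraicGeometry.Resolution IsLocalRing
open scoped Pointwise IntermediateField

universe u

/-- The unique extension of `O` to a normal extension is stabilised by every automorphism.
[folklore] -/
theorem smul_eq_of_unique {K L : Type u} [Field K] [Field L] [Algebra K L]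
    (W : ValuationSubring L) {O : ValuationSubring K} (hWO : W.comap (algebraMap K L) = O)
    (huniq : ∀ W' : ValuationSubring L, W'.comap (algebraMap K L) = O → W' = W)
    (σ : L ≃ₐ[K] L) : σ • W = W :=
  huniq (σ • W) (by rw [Resolution.ValuationSubring.comap_smul, hWO])

/-- **Coarse moves**: `BMove3` with the wild constructors `galoisP`/`inseparableP` (immediate
case) and the wild uses of `primeUp` (`f = p` or `e = p`) merged into the hypothesis-free
`galoisStep` / `inseparableStep`. [cite: CossartPiltant2008, Thm 7.2 proof (HAL pp. 20–21)] -/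
inductive CMove3 (k : Type u) [Field k] : VState k → VState k → Prop
  | inertiaUp {K : Type u} [Field K] [Algebra k K] {L : Type u} [Field L] [Algebra K L]
      [Algebra k L] [IsScalarTower k K L] (hfin : FiniteDimensional K L) (hgal : IsGalois K L)
      (W : ValuationSubring L) (hkW : ∀ c : k, algebraMap k L c ∈ W) (K' : IntermediateField K L)
      (hK' : LeInertiaField K W K') :
      CMove3 k ⟨K, W.comap (algebraMap K L), forall_algebraMap_mem_comap hkW⟩
        ⟨K', W.comap (algebraMap K' L), forall_algebraMap_mem_comap_intermediateField hkW K'⟩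
  | primeUp {K : Type u} [Field K] [Algebra k K] {L : Type u} [Field L] [Algebra K L]
      [Algebra k L] [IsScalarTower k K L] (hprime : (Module.finrank K L).Prime)
      (W : ValuationSubring L) (hkW : ∀ c : k, algebraMap k L c ∈ W)
      (hef : inertiaDegree K W = Module.finrank K L ∨ ramificationIndex K W = Module.finrank K L) :
      CMove3 k ⟨K, W.comap (algebraMap K L), forall_algebraMap_mem_comap hkW⟩ ⟨L, W, hkW⟩
  | galoisStep {K : Type u} [Field K] [Algebra k K] (O : ValuationSubring K)
      (hk : ∀ c : k, algebraMap k K c ∈ O) (p : ℕ) (hp : p.Prime) (hchar : CharP k p)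
      {L : Type u} [Field L] [Algebra K L] [Algebra k L] [IsScalarTower k K L]
      (hfin : FiniteDimensional K L) (hgal : IsGalois K L) (hdeg : Module.finrank K L = p)
      (W : ValuationSubring L) (hkW : ∀ c : k, algebraMap k L c ∈ W)
      (hWO : W.comap (algebraMap K L) = O)
      (huniq : ∀ W' : ValuationSubring L, W'.comap (algebraMap K L) = O → W' = W) :
      CMove3 k ⟨K, O, hk⟩ ⟨L, W, hkW⟩
  | inseparableStep {K : Type u} [Field K] [Algebra k K] (O : ValuationSubring K)
      (hk : ∀ c : k, algebraMap k K c ∈ O) (p : ℕ) (hp : p.Prime) (hchar : CharP k p)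
      (hkp : ¬ PerfectField k) {L : Type u} [Field L] [Algebra K L] [Algebra k L]
      [IsScalarTower k K L] (hfin : FiniteDimensional K L) (hdeg : Module.finrank K L = p)
      (η : L) (b₀ : K) (hη : η ^ p = algebraMap K L b₀) (hηtop : K⟮η⟯ = ⊤)
      (W : ValuationSubring L) (hkW : ∀ c : k, algebraMap k L c ∈ W)
      (hWO : W.comap (algebraMap K L) = O) :
      CMove3 k ⟨K, O, hk⟩ ⟨L, W, hkW⟩
  | ramificationDown {K : Type u} [Field K] [Algebra k K] {L : Type u} [Field L] [Algebra K L]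
      [Algebra k L] [IsScalarTower k K L] (hfin : FiniteDimensional K L) (hgal : IsGalois K L)
      (W : ValuationSubring L) (hkW : ∀ c : k, algebraMap k L c ∈ W) (K' : IntermediateField K L)
      (hK' : LeRamificationField K W K') :
      CMove3 k ⟨K', W.comap (algebraMap K' L), forall_algebraMap_mem_comap_intermediateField hkW K'⟩
        ⟨K, W.comap (algebraMap K L), forall_algebraMap_mem_comap hkW⟩
  | iso {K₁ K₂ : Type u} [Field K₁] [Algebra k K₁] [Field K₂] [Algebra k K₂] (e : K₁ ≃ₐ[k] K₂)
      (O : ValuationSubring K₂) (hk : ∀ c : k, algebraMap k K₂ c ∈ O) :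
      CMove3 k ⟨K₁, O.comap (e : K₁ →+* K₂), forall_algebraMap_mem_comap_algEquiv e hk⟩ ⟨K₂, O, hk⟩

/-- **Finitely many coarse steps.** [folklore] -/
def CReach3 (k : Type u) [Field k] : VState k → VState k → Prop :=
  Relation.ReflTransGen (CMove3 k)

/-- Every bare move is a coarse move (forget `himm`). [folklore] -/
theorem BMove3.toCMove3 {k : Type u} [Field k] {s t : VState k} (h : BMove3 k s t) :
    CMove3 k s t := by
  cases h with
  | inertiaUp hfin hgal W hkW K' hK' => exact CMove3.inertiaUp hfin hgal W hkW K' hK'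
  | primeUp hprime W hkW hef => exact CMove3.primeUp hprime W hkW hef
  | galoisP O hk p hp hchar hfin hgal hdeg W hkW hWO huniq himm =>
    exact CMove3.galoisStep O hk p hp hchar hfin hgal hdeg W hkW hWO huniq
  | inseparableP O hk p hp hchar hkp hfin hdeg η b₀ hη hηtop W hkW hWO himm =>
    exact CMove3.inseparableStep O hk p hp hchar hkp hfin hdeg η b₀ hη hηtop W hkW hWO
  | ramificationDown hfin hgal W hkW K' hK' => exact CMove3.ramificationDown hfin hgal W hkW K' hK'
  | iso e O hk => exact CMove3.iso e O hk

/-- **A coarse move is a bare move** — PROVED (clause T-c): at a wild step the trichotomy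
`trichotomy_of_isGalois` / `trichotomy_of_pthRoot` decides between the immediate constructor
and `primeUp`. [cite: CossartPiltant2008, Thm 7.2 proof (HAL p. 20)] -/
theorem CMove3.toBReach3 {k : Type u} [Field k] {s t : VState k} (h : CMove3 k s t) :
    BReach3 k s t := by
  cases h with
  | inertiaUp hfin hgal W hkW K' hK' =>
    exact Relation.ReflTransGen.single (BMove3.inertiaUp hfin hgal W hkW K' hK')
  | primeUp hprime W hkW hef => exact Relation.ReflTransGen.single (BMove3.primeUp hprime W hkW hef)
  | @galoisStep K _ _ O hk p hp hchar L _ _ _ _ hfin hgal hdeg W hkW hWO huniq =>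
    haveI := hfin
    haveI := hgal
    haveI : Fact p.Prime := ⟨hp⟩
    haveI : CharP K p := by
      haveI := hchar
      exact charP_of_injective_algebraMap (algebraMap k K).injective p
    have hW : ∀ σ : L ≃ₐ[K] L, σ • W = W := smul_eq_of_unique W hWO huniq
    rcases trichotomy_of_isGalois hdeg W hW with himm | hef
    · exact Relation.ReflTransGen.single
        (BMove3.galoisP O hk p hp hchar hfin hgal hdeg W hkW hWO huniq himm)
    · subst hWO
      exact Relation.ReflTransGen.single (BMove3.primeUp (hdeg ▸ hp) W hkW hef)
  | @inseparableStep K _ _ O hk p hp hchar hkp L _ _ _ _ hfin hdeg η b₀ hη hηtop W hkW hWO =>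
    haveI := hfin
    haveI : Fact p.Prime := ⟨hp⟩
    haveI : CharP K p := by
      haveI := hchar
      exact charP_of_injective_algebraMap (algebraMap k K).injective p
    rcases trichotomy_of_pthRoot hdeg hη hηtop W with himm | hef
    · exact Relation.ReflTransGen.single
        (BMove3.inseparableP O hk p hp hchar hkp hfin hdeg η b₀ hη hηtop W hkW hWO himm)
    · subst hWO
      exact Relation.ReflTransGen.single (BMove3.primeUp (hdeg ▸ hp) W hkW hef)
  | ramificationDown hfin hgal W hkW K' hK' =>
    exact Relation.ReflTransGen.single (BMove3.ramificationDown hfin hgal W hkW K' hK')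
  | iso e O hk => exact Relation.ReflTransGen.single (BMove3.iso e O hk)

/-- Chains: coarse to bare. [folklore] -/
theorem CReach3.toBReach3 {k : Type u} [Field k] {s t : VState k} (h : CReach3 k s t) :
    BReach3 k s t := by
  induction h with
  | refl => exact Relation.ReflTransGen.refl
  | tail _ hm ih => exact ih.trans hm.toBReach3

/-- Chains: bare to coarse. [folklore] -/
theorem BReach3.toCReach3 {k : Type u} [Field k] {s t : VState k} (h : BReach3 k s t) :
    CReach3 k s t := by
  induction h with
  | refl => exact Relation.ReflTransGen.refl
  | tail _ hm ih => exact Relation.ReflTransGen.tail ih hm.toCMove3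

/-- A coarse chain from an admissible stage is a `GMove3`-chain. [folklore] -/
theorem CReach3.toGReach3 {k : Type u} [Field k] {s t : VState k} (h : CReach3 k s t)
    (hs : s.Adm) : GReach3 k s t :=
  (h.toBReach3.adm_and_toGReach3 hs).2

/-! ### The coarse tower fact -/

/-- **The tower of the proof of Thm 7.2 exists, coarse** (Cossart–Piltant 2008, HAL pp. 20–21)
— NAMED FACT, `BareTowerExists2008` with clause T-c (the `(e, f)`-trichotomy at the wild steps)
removed as well: the stage `(K, V)` is reached from `(k(x), V ∩ k(x))` by finitely many COARSE
moves `CMove3` (climb inside the inertia field; prime-degree steps with `f` or `e` equal to the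
degree; Galois steps of degree `p` along which the valuation extends uniquely; simple purely
inseparable steps of degree `p`; descents from below the ramification field; isomorphisms).
[cite: CossartPiltant2008, Thm 7.2 proof (HAL pp. 20–21)] -/
def CoarseTowerExists2008 (k : Type u) [Field k] : Prop :=
  ∀ (p : ℕ), p.Prime → CharP k p →
  ∀ (K : Type u) [Field K] [Algebra k K], (⊤ : IntermediateField k K).FG → Algebra.trdeg k K = 3 →
  ∀ (O : ValuationSubring K) (hk : ∀ c : k, algebraMap k K c ∈ O), Nonempty O.valuation.RankOne →
    residueTrdeg k O hk = 0 →
  ∀ (x : Fin 3 → K), IsTranscendenceBasis k x →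
    (PerfectField k → Algebra.IsSeparable (IntermediateField.adjoin k (Set.range x)) K) →
    CReach3 k (baseStage x O hk) ⟨K, O, hk⟩

/-- **Coarse ↔ bare.** [folklore] -/
theorem coarseTowerExists2008_iff_bare {k : Type u} [Field k] :
    CoarseTowerExists2008 k ↔ BareTowerExists2008 k :=
  ⟨fun hC p hp hchar K _ _ hfg h3 O hk h1 halg x hx hsep =>
      (hC p hp hchar K hfg h3 O hk h1 halg x hx hsep).toBReach3,
    fun hB p hp hchar K _ _ hfg h3 O hk h1 halg x hx hsep =>
      (hB p hp hchar K hfg h3 O hk h1 halg x hx hsep).toCReach3⟩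

/-- **Coarse ↔ `GaloisTowerExists2008`.** [folklore] -/
theorem coarseTowerExists2008_iff {k : Type u} [Field k] :
    CoarseTowerExists2008 k ↔ GaloisTowerExists2008 k :=
  coarseTowerExists2008_iff_bare.trans bareTowerExists2008_iff

/-- **`TowerExists2008` from the coarse tower** — PROVED.
[cite: CossartPiltant2008, Thm 7.2 proof (HAL pp. 20–21)] -/
theorem towerExists2008_of_coarseTower {k : Type u} [Field k] (hC : CoarseTowerExists2008 k) :
    TowerExists2008 k :=
  towerExists2008_of_bareTower (coarseTowerExists2008_iff_bare.mp hC)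

/-- **Theorem 7.2 from its leaves, with the coarse tower** — PROVED.
[cite: CossartPiltant2008, Thm 7.2 (HAL pp. 19–21)] -/
theorem reductionToArtinSchreier_of_coarseTower (h63 : ClimbToInertiaField.{u})
    (h83 : PrimeDegreeAscent.{u}) (h95 : DescentBelowRamificationField.{u})
    (hC : ∀ (k : Type u) [Field k], CoarseTowerExists2008 k) : ReductionToArtinSchreier.{u} :=
  reductionToArtinSchreier_of_bareTower h63 h83 h95
    fun k _ => coarseTowerExists2008_iff_bare.mp (hC k)

/-- **`LU3DiffFinite` from its leaves, with the coarse tower** — PROVED: Prop 5.1, Cor 6.3,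
Prop 8.3, Prop 9.5, `CoarseTowerExists2008` and [CP2]'s Main theorem.
[cite: CossartPiltant2008, Thm 2.1 proof (HAL pp. 3–4, 16, 19–21)] -/
theorem lu3DiffFinite_of_coarseTower (p51 : RankReduction.{u}) (h63 : ClimbToInertiaField.{u})
    (h83 : PrimeDegreeAscent.{u}) (h95 : DescentBelowRamificationField.{u})
    (hC : ∀ (k : Type u) [Field k], CoarseTowerExists2008 k) (cp2 : CossartPiltant2009Main.{u}) :
    LU3DiffFinite.{u} :=
  lu3DiffFinite_of_bareTower p51 h63 h83 h95 (fun k _ => coarseTowerExists2008_iff_bare.mp (hC k)) cp2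

end Literature.AlgebraicGeometry.CossartPiltant200819.CP2008
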